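/-
Origin: expansion seat `prover-pub-hodgecm-mc-binder-2-g19-0`, handover #100 2026-08-21T00:27Z md5 9152ca8a7c61 (NEW; 260 l.; ns HodgeCM.SignRecipe + HodgeCM.Model; the pointwise hsmall socket (#95 ∕ axioms-1 #6r2) with the SLOT CLAUSE RE-READ for K0-RIDER-2-compatible pins (theta-3-g27 ENUMERATION READ l.14809: ONE Gram representative per line class ⇒ the pinned line's scalar is a_i only up to Nm(L^×)·(L⁺)^×_{≫0}, so the scalar equation (line j).scalar = a_i is the wrong currency; Φ^δ is invariant under exactly these rescalings, #96): SignRecipe.lineType_eq_of_isometric (Φ^δ(z z̄ a) = Φ^δ(a) from b = z z̄ a), **hsmall_of_tower_at_of_lineType_eq** (#95 with slot clause the TYPE EQUATION Φ^δ(scalar μ) = Φ^δ(a_i), generic Char; (J4a) by #96 liftTyped_of_lineType_eq), **hsmall_of_tower_at_of_isometric** (slot clause ∃ z ≠ 0, scalar μ = z z̄ · a_i = «index line ISOMETRIC to the slot line»), hsmall_of_weilFamily_at_of_lineType_eq ∕ hsmall_of_weilFamilyAut_at_of_lineType_eq ∕ **hsmall_of_weilFamilyAut_at_of_isometric** (the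 same over axioms-1's INDEXED instance liuDictionaryOfWeilFamily[Aut] … ιV I line, slot clause (line j).lineType = Φ^δ(a_i) resp. ∃ z ≠ 0, (line j).scalar = z z̄ · a_i); conclusion in every case E's hsmall clause at (V, c, i); nothing cited (hcite is the hypothesis). CERT lane farm (same mirror): rc 0 ∕ 25 s ∕ 0 warn ∕ 0 proof holes; #print axioms 6 ∕ 6 ⊆ trio, proof-holeAx 0 (g19∕farm∕logs∕ax_lte.log 9ffbb6586b7f); FQN 0 ∕ 6. NAME LIST (theorems): HodgeCM.Model.hsmall_of_tower_at_of_lineType_eq · HodgeCM.Model.hsmall_of_tower_at_of_isometric · HodgeCM.Model.hsmall_of_weilFamilyAut_at_of_isometric. (`HOME/mc/pub-hodgecm-mc-binder-2/g19/stage68/HodgeCM/Model/HsmallOfTowerAtLineTypeEq.lean`, md5 9152ca8a7c61, 260 lines);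
landed by the second packager p2 gen 16 (p2-g16) in gate run 68 as `HodgeCM/Model/HsmallOfTowerAtLineTypeEq.lean` (verbatim).
-/
/-
Origin: BINDER seat `prover-pub-hodgecm-mc-binder-2-g19-0` (unit pub-hodgecm-mc-binder-2-g19, gen 19 of mc-binder-2), 2026-08-21.
Target in PKG: `HodgeCM/Model/HsmallOfTowerAtLineTypeEq.lean` (NEW additive KERNEL leaf beside E; imports LANDED axioms-1 #6r2
`Model/LiuDictionaryInstanceLevel` + binder-2 #96 `Model/Binders/JLiuLineTypeScale`; nothing imports it; outside E's import closure;
E `Model/E2InstanceOGR21AEPI.lean` 4c667377ea4b untouched; MODEL-N ±0).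
KERNEL ONLY: theorems; 0 defs, 0 records, nothing cited, 0 `def … : Prop`. Nothing here is a claim of the manuscripts under adjudication.
-/
import Summits.HodgeConjecture.HodgeCM.Model.LiuDictionaryInstanceLevel
import Summits.HodgeConjecture.HodgeCM.Model.Binders.JLiuLineTypeScale

set_option autoImplicit false

/-!
# (J3) The pointwise `hsmall` socket with the slot clause as a TYPE EQUATION / an ISOMETRY (K0 RIDER 2-compatible pins)

binder-2 #95 `hsmall_of_tower_at_of_scalar` and axioms-1 #6r2 `hsmall_of_weilFamily(Aut)_at` read the slot clause of the junction as
the SCALAR EQUATION `(line j).scalar = c.D.a i`.  K0 RIDER 2 (#98 `line_injective_of_muSeparated_aut`: the cited `MuSeparated` forces the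
theta lane's index `I` to list each ISOMETRY class of split lines ONCE) means the pinned `line j` is a REPRESENTATIVE of the class of the
slot line `⟨a_i⟩`, whose Gram scalar is `a_i` only up to `Nm(L^×) · (L⁺)^×_{≫0}` — so the scalar equation is the wrong currency at a
rider-2-compliant pin.  This leaf re-reads the socket through binder-2 #96 (`Φ^δ` is invariant under exactly those rescalings):

* `SignRecipe.lineType_eq_of_isometric` — `Φ^δ(z z̄ · a) = Φ^δ(a)` read from an equation `b = z z̄ · a` (#96 + #94 `lineType_congr`);
* `hsmall_of_tower_at_of_lineType_eq` — #95 with the slot clause weakened to the TYPE EQUATION `Φ^δ(scalar μ) = Φ^δ(a_i)` (generic `Char`);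
* `hsmall_of_tower_at_of_isometric` — #95 with the slot clause `∃ z ≠ 0, scalar μ = z z̄ · a_i` («the index line is ISOMETRIC to the
  slot line», hermitian lines: `⟨b⟩ ≅ ⟨a⟩ ↔ b ∈ Nm(L^×) a`), via #96 `lineType_mul_conj_mul_eq`;
* `hsmall_of_weilFamily_at_of_lineType_eq` ∕ `hsmall_of_weilFamilyAut_at_of_lineType_eq` ∕ `hsmall_of_weilFamilyAut_at_of_isometric` —
  the same over axioms-1's INDEXED instance `liuDictionaryOfWeilFamily[Aut] … ιV I line` (#6r2), slot clause `(line j).lineType = Φ^δ(a_i)`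
  resp. `∃ z ≠ 0, (line j).scalar = z z̄ · a_i`.
Conclusion in every case: E's `hsmall` clause at `(V, c, i)`.  Nothing is cited here: the five sentences are the hypothesis `hcite`.
-/

noncomputable section

open Function Set
open NumberField
open Literature.AlgebraicGeometry.Motives
open Literature.AlgebraicGeometry.ShimuraVarieties
open Literature.AlgebraicGeometry.HodgeTheory
open Literature.NumberTheory.Automorphic
open Literature.NumberTheory.Automorphic.PicardCM
open Literature.NumberTheory.Transcendental (Arapura2012_Cor_15_4_6)

namespace HodgeCM

namespace SignRecipe

variable {L : CMField}

/-- **`Φ^δ(b) = Φ^δ(a)` for ISOMETRIC hermitian lines** `b = z z̄ · a`, `z ≠ 0` (#96 `lineType_mul_conj_mul_eq` read from an equation).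
[folklore] -/
theorem lineType_eq_of_isometric {a b z : L} (hz : z ≠ 0) (ha : conjRingHomK L a = a) (ha0 : a ≠ 0)
    (hb : conjRingHomK L b = b) (hb0 : b ≠ 0) (h : b = z * conjRingHomK L z * a) :
    lineType b hb hb0 = lineType a ha ha0 := by
  subst h
  exact lineType_mul_conj_mul_eq hz ha ha0 hb hb0

end SignRecipe

namespace Model

open HodgeCM.Model.TowerLevel HodgeCM.Model.TowerCarrier HodgeCM.Literature.Theta HodgeCM.Literature.Theta.LiuAlbaneseModuleDatum
open HodgeCM.CMTypeOps (inflate)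
open HodgeCM.Universe (ThetaModel)
open HodgeCM.SignRecipe (lineType liftType)

variable (hHD : exists_isReal_hodgeModel) (hI : hodgePQ_independent_of_hodgeModel)
  (h₁ : BallQuotientUniformised) (h₃ : CMAbelianVarietyRealised)

/-! ## §1. Generic `Char`: the slot clause as a type equation / an isometry -/

/-- **E's `hsmall` through the tower in ONE call, slot clause = TYPE EQUATION** (#95 `hsmall_of_tower_at_of_scalar` with
`scalar μ = c.D.a i` weakened to `Φ^δ(scalar μ) = Φ^δ(c.D.a i)`; the (J4a) clause by #96 `liftTyped_of_lineType_eq`). [folklore] -/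
theorem hsmall_of_tower_at_of_lineType_eq (hR : DeligneMilne1982_Thm_6_20_full) (hA : Arapura2012_Cor_15_4_6)
    (R : (picardCMUniverse hHD hI h₁ h₃).ThetaModel)
    {L : CMField} {ι₁ : L →+* ℂ} (V : HermSpace3 L ι₁) (c : SeesawCtx L)
    (Char : Type) (Adm : Char → Type) (Ω : (μ : Char) → Adm μ → Type)
    [∀ μ a, AddCommGroup (Ω μ a)] [∀ μ a, Module ℂ (Ω μ a)] [∀ μ a, Module (adelicAlgebra V) (Ω μ a)]
    [∀ μ a, IsScalarTower ℂ (adelicAlgebra V) (Ω μ a)]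
    (scalar : Char → L) (hreal : ∀ μ, conjRingHomK L (scalar μ) = scalar μ) (hne : ∀ μ, scalar μ ≠ 0)
    (hcite : (LiuDictionary.ofTower hHD hI h₁ h₃ hA V Char Adm Ω
        (fun μ => ι₁ ∈ (lineType (scalar μ) (hreal μ) (hne μ)).1)
        (fun μ d => d.IsReflexOfTypeG ι₁ (lineType (scalar μ) (hreal μ) (hne μ)))).Irreducible ∧
      (LiuDictionary.ofTower hHD hI h₁ h₃ hA V Char Adm Ω
        (fun μ => ι₁ ∈ (lineType (scalar μ) (hreal μ) (hne μ)).1)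
        (fun μ d => d.IsReflexOfTypeG ι₁ (lineType (scalar μ) (hreal μ) (hne μ)))).Prop413 ∧
      (LiuDictionary.ofTower hHD hI h₁ h₃ hA V Char Adm Ω
        (fun μ => ι₁ ∈ (lineType (scalar μ) (hreal μ) (hne μ)).1)
        (fun μ d => d.IsReflexOfTypeG ι₁ (lineType (scalar μ) (hreal μ) (hne μ)))).Thm418_2 ∧
      (LiuDictionary.ofTower hHD hI h₁ h₃ hA V Char Adm Ω
        (fun μ => ι₁ ∈ (lineType (scalar μ) (hreal μ) (hne μ)).1)
        (fun μ d => d.IsReflexOfTypeG ι₁ (lineType (scalar μ) (hreal μ) (hne μ)))).MuSeparated ∧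
      (LiuDictionary.ofTower hHD hI h₁ h₃ hA V Char Adm Ω
        (fun μ => ι₁ ∈ (lineType (scalar μ) (hreal μ) (hne μ)).1)
        (fun μ d => d.IsReflexOfTypeG ι₁ (lineType (scalar μ) (hreal μ) (hne μ)))).Thm418C)
    (hgood : R.GoodCtx ι₁ c) (hrec : SignRecipe.GoodCtx (Model.orientBitι L ι₁) ι₁ c)
    (h6 : Module.finrank ℚ c.K = 6 ∧ IsNormalClosure ℚ c.K L ∧ (Module.finrank ℚ L = 24 ∨ Module.finrank ℚ L = 48))
    (i : Fin 4)
    (hJS : ∃ S : Finset Char,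
        (∀ μ ∈ S, lineType (scalar μ) (hreal μ) (hne μ) = lineType (c.D.a i) (c.D.a_real i) (c.D.a_ne i)) ∧
        ∀ (Γ : Level V) (hΓ : Γ.BelowConjThree), ∀ ω ∈ R.Theta V c i Γ,
          ∃ cf : towerLevel hHD hI (ballQuotientUniformisedDatum_of h₁) h₃ hA Γ hΓ,
            TowerLevel.res hHD hI (ballQuotientUniformisedDatum_of h₁) h₃ hA cf = ω ∧
              (ofLevel hHD hI (ballQuotientUniformisedDatum_of h₁) h₃ hA Γ hΓ cf :
                  (LiuDictionary.ofTower hHD hI h₁ h₃ hA V Char Adm Ω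
                    (fun μ => ι₁ ∈ (lineType (scalar μ) (hreal μ) (hne μ)).1)
                    (fun μ d => d.IsReflexOfTypeG ι₁ (lineType (scalar μ) (hreal μ) (hne μ)))).H) ∈
                ⨆ μ ∈ S, (LiuDictionary.ofTower hHD hI h₁ h₃ hA V Char Adm Ω
                  (fun μ => ι₁ ∈ (lineType (scalar μ) (hreal μ) (hne μ)).1)
                  (fun μ d => d.IsReflexOfTypeG ι₁ (lineType (scalar μ) (hreal μ) (hne μ)))).block μ) :
    ∃ Γ₀ : Level V, ∀ Γ ≤ Γ₀,
      ∃ (M : CMField) (k : c.K →+* M) (σ' : M →+* ℂ), σ'.comp k = c.σ ∧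
        R.Theta V c i Γ ⊆ (picardCMUniverse hHD hI h₁ h₃).Uiso Γ M (inflate k (c.Ψ i)) σ' := by
  obtain ⟨S, hS, hfam⟩ := hJS
  exact hsmall_of_tower_at_of_typeOf hHD hI h₁ h₃ hR hA R V c Char Adm Ω
    (fun μ => lineType (scalar μ) (hreal μ) (hne μ)) hcite hgood h6 i
    ⟨S, fun μ hμ => liftTyped_of_lineType_eq scalar hreal hne _ (fun _ => rfl) h6.2.1 hrec (hS μ hμ), hfam⟩

/-- **E's `hsmall` through the tower in ONE call, slot clause = ISOMETRY WITH THE SLOT LINE** (`∃ z ≠ 0, scalar μ = z z̄ · a_i`; #96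
`lineType_mul_conj_mul_eq`). [folklore] -/
theorem hsmall_of_tower_at_of_isometric (hR : DeligneMilne1982_Thm_6_20_full) (hA : Arapura2012_Cor_15_4_6)
    (R : (picardCMUniverse hHD hI h₁ h₃).ThetaModel)
    {L : CMField} {ι₁ : L →+* ℂ} (V : HermSpace3 L ι₁) (c : SeesawCtx L)
    (Char : Type) (Adm : Char → Type) (Ω : (μ : Char) → Adm μ → Type)
    [∀ μ a, AddCommGroup (Ω μ a)] [∀ μ a, Module ℂ (Ω μ a)] [∀ μ a, Module (adelicAlgebra V) (Ω μ a)]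
    [∀ μ a, IsScalarTower ℂ (adelicAlgebra V) (Ω μ a)]
    (scalar : Char → L) (hreal : ∀ μ, conjRingHomK L (scalar μ) = scalar μ) (hne : ∀ μ, scalar μ ≠ 0)
    (hcite : (LiuDictionary.ofTower hHD hI h₁ h₃ hA V Char Adm Ω
        (fun μ => ι₁ ∈ (lineType (scalar μ) (hreal μ) (hne μ)).1)
        (fun μ d => d.IsReflexOfTypeG ι₁ (lineType (scalar μ) (hreal μ) (hne μ)))).Irreducible ∧
      (LiuDictionary.ofTower hHD hI h₁ h₃ hA V Char Adm Ω
        (fun μ => ι₁ ∈ (lineType (scalar μ) (hreal μ) (hne μ)).1)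
        (fun μ d => d.IsReflexOfTypeG ι₁ (lineType (scalar μ) (hreal μ) (hne μ)))).Prop413 ∧
      (LiuDictionary.ofTower hHD hI h₁ h₃ hA V Char Adm Ω
        (fun μ => ι₁ ∈ (lineType (scalar μ) (hreal μ) (hne μ)).1)
        (fun μ d => d.IsReflexOfTypeG ι₁ (lineType (scalar μ) (hreal μ) (hne μ)))).Thm418_2 ∧
      (LiuDictionary.ofTower hHD hI h₁ h₃ hA V Char Adm Ω
        (fun μ => ι₁ ∈ (lineType (scalar μ) (hreal μ) (hne μ)).1)
        (fun μ d => d.IsReflexOfTypeG ι₁ (lineType (scalar μ) (hreal μ) (hne μ)))).MuSeparated ∧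
      (LiuDictionary.ofTower hHD hI h₁ h₃ hA V Char Adm Ω
        (fun μ => ι₁ ∈ (lineType (scalar μ) (hreal μ) (hne μ)).1)
        (fun μ d => d.IsReflexOfTypeG ι₁ (lineType (scalar μ) (hreal μ) (hne μ)))).Thm418C)
    (hgood : R.GoodCtx ι₁ c) (hrec : SignRecipe.GoodCtx (Model.orientBitι L ι₁) ι₁ c)
    (h6 : Module.finrank ℚ c.K = 6 ∧ IsNormalClosure ℚ c.K L ∧ (Module.finrank ℚ L = 24 ∨ Module.finrank ℚ L = 48))
    (i : Fin 4)
    (hJS : ∃ S : Finset Char,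
        (∀ μ ∈ S, ∃ z : L, z ≠ 0 ∧ scalar μ = z * conjRingHomK L z * c.D.a i) ∧
        ∀ (Γ : Level V) (hΓ : Γ.BelowConjThree), ∀ ω ∈ R.Theta V c i Γ,
          ∃ cf : towerLevel hHD hI (ballQuotientUniformisedDatum_of h₁) h₃ hA Γ hΓ,
            TowerLevel.res hHD hI (ballQuotientUniformisedDatum_of h₁) h₃ hA cf = ω ∧
              (ofLevel hHD hI (ballQuotientUniformisedDatum_of h₁) h₃ hA Γ hΓ cf :
                  (LiuDictionary.ofTower hHD hI h₁ h₃ hA V Char Adm Ω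
                    (fun μ => ι₁ ∈ (lineType (scalar μ) (hreal μ) (hne μ)).1)
                    (fun μ d => d.IsReflexOfTypeG ι₁ (lineType (scalar μ) (hreal μ) (hne μ)))).H) ∈
                ⨆ μ ∈ S, (LiuDictionary.ofTower hHD hI h₁ h₃ hA V Char Adm Ω
                  (fun μ => ι₁ ∈ (lineType (scalar μ) (hreal μ) (hne μ)).1)
                  (fun μ d => d.IsReflexOfTypeG ι₁ (lineType (scalar μ) (hreal μ) (hne μ)))).block μ) :
    ∃ Γ₀ : Level V, ∀ Γ ≤ Γ₀,
      ∃ (M : CMField) (k : c.K →+* M) (σ' : M →+* ℂ), σ'.comp k = c.σ ∧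
        R.Theta V c i Γ ⊆ (picardCMUniverse hHD hI h₁ h₃).Uiso Γ M (inflate k (c.Ψ i)) σ' := by
  obtain ⟨S, hS, hfam⟩ := hJS
  refine hsmall_of_tower_at_of_lineType_eq hHD hI h₁ h₃ hR hA R V c Char Adm Ω scalar hreal hne hcite hgood hrec h6 i
    ⟨S, fun μ hμ => ?_, hfam⟩
  obtain ⟨z, hz, hzeq⟩ := hS μ hμ
  exact SignRecipe.lineType_eq_of_isometric hz (c.D.a_real i) (c.D.a_ne i) (hreal μ) (hne μ) hzeq

/-! ## §2. Over axioms-1's INDEXED instance (#6r2): the slot clause on `(line j).lineType` / by isometry -/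

variable (hA : Arapura2012_Cor_15_4_6)
variable {L : CMField} {ι₁ : (L : Type) →+* ℂ} (V : HermSpace3 L ι₁)
variable {JV : Matrix (Fin 3) (Fin 3) (L : Type)} {TV : Matrix (Fin 3) (Fin 3) ↥(maximalRealSubfield (L : Type))}
  {δ : (L : Type)} {hcδ : IsCMField.complexConj (L : Type) δ = -δ} {hδ : δ ≠ 0} {d : ↥(maximalRealSubfield (L : Type))}
  {hd : δ * δ = algebraMap _ (L : Type) d} {hV : TV.IsSymm} {hVd : IsUnit TV.det}
  {hJV : JV = TV.map (algebraMap _ (L : Type))}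
  (ιV : ↥V.adelicFin →*
    ↥(UnitaryGroup.finAdelic (↥(maximalRealSubfield (L : Type))) (L : Type) (IsCMField.complexConj (L : Type)) 3 JV))
  (I : Type) (line : I → SplitLine JV TV hcδ hδ hd hV hVd hJV) (GoodCharI : (i : I) → (line i).CharW → Prop)

/-- **E's `hsmall` OVER THE INDEXED INSTANCE, slot clause = TYPE EQUATION `(line j).lineType = Φ^δ(a_i)`.** [folklore] -/
theorem hsmall_of_weilFamily_at_of_lineType_eq (hR : DeligneMilne1982_Thm_6_20_full)
    (R : (picardCMUniverse hHD hI h₁ h₃).ThetaModel) (c : SeesawCtx L)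
    (hcite : (liuDictionaryOfWeilFamily hHD hI h₁ h₃ hA V ιV I line GoodCharI).Irreducible ∧
      (liuDictionaryOfWeilFamily hHD hI h₁ h₃ hA V ιV I line GoodCharI).Prop413 ∧
      (liuDictionaryOfWeilFamily hHD hI h₁ h₃ hA V ιV I line GoodCharI).Thm418_2 ∧
      (liuDictionaryOfWeilFamily hHD hI h₁ h₃ hA V ιV I line GoodCharI).MuSeparated ∧
      (liuDictionaryOfWeilFamily hHD hI h₁ h₃ hA V ιV I line GoodCharI).Thm418C)
    (hgood : R.GoodCtx ι₁ c) (hrec : SignRecipe.GoodCtx (Model.orientBitι L ι₁) ι₁ c)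
    (h6 : Module.finrank ℚ c.K = 6 ∧ IsNormalClosure ℚ c.K L ∧ (Module.finrank ℚ L = 24 ∨ Module.finrank ℚ L = 48))
    (i : Fin 4)
    (hJS : ∃ S : Finset I,
        (∀ j ∈ S, (line j).lineType = lineType (c.D.a i) (c.D.a_real i) (c.D.a_ne i)) ∧
        ∀ (Γ : Level V) (hΓ : Γ.BelowConjThree), ∀ ω ∈ R.Theta V c i Γ,
          ∃ cf : towerLevel hHD hI (ballQuotientUniformisedDatum_of h₁) h₃ hA Γ hΓ,
            TowerLevel.res hHD hI (ballQuotientUniformisedDatum_of h₁) h₃ hA cf = ω ∧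
              (ofLevel hHD hI (ballQuotientUniformisedDatum_of h₁) h₃ hA Γ hΓ cf :
                  (liuDictionaryOfWeilFamily hHD hI h₁ h₃ hA V ιV I line GoodCharI).H) ∈
                ⨆ j ∈ S, (liuDictionaryOfWeilFamily hHD hI h₁ h₃ hA V ιV I line GoodCharI).block j) :
    ∃ Γ₀ : Level V, ∀ Γ ≤ Γ₀,
      ∃ (M : CMField) (k : c.K →+* M) (σ' : M →+* ℂ), σ'.comp k = c.σ ∧
        R.Theta V c i Γ ⊆ (picardCMUniverse hHD hI h₁ h₃).Uiso Γ M (inflate k (c.Ψ i)) σ' :=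
  hsmall_of_tower_at_of_lineType_eq hHD hI h₁ h₃ hR hA R V c I (fun j => {χ : (line j).CharW // GoodCharI j χ})
    (fun j a => (line j).Ω ιV a.1) (fun j => (line j).scalar) (fun j => (line j).conj_scalar)
    (fun j => (line j).scalar_ne_zero) hcite hgood hrec h6 i hJS

/-- **the same at the `GoodChar` OF RECORD** (`liuDictionaryOfWeilFamilyAut`, `GoodChar := IsAutChar`). [folklore] -/
theorem hsmall_of_weilFamilyAut_at_of_lineType_eq (hR : DeligneMilne1982_Thm_6_20_full)
    (R : (picardCMUniverse hHD hI h₁ h₃).ThetaModel) (c : SeesawCtx L)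
    (hcite : (liuDictionaryOfWeilFamilyAut hHD hI h₁ h₃ hA V ιV I line).Irreducible ∧
      (liuDictionaryOfWeilFamilyAut hHD hI h₁ h₃ hA V ιV I line).Prop413 ∧
      (liuDictionaryOfWeilFamilyAut hHD hI h₁ h₃ hA V ιV I line).Thm418_2 ∧
      (liuDictionaryOfWeilFamilyAut hHD hI h₁ h₃ hA V ιV I line).MuSeparated ∧
      (liuDictionaryOfWeilFamilyAut hHD hI h₁ h₃ hA V ιV I line).Thm418C)
    (hgood : R.GoodCtx ι₁ c) (hrec : SignRecipe.GoodCtx (Model.orientBitι L ι₁) ι₁ c)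
    (h6 : Module.finrank ℚ c.K = 6 ∧ IsNormalClosure ℚ c.K L ∧ (Module.finrank ℚ L = 24 ∨ Module.finrank ℚ L = 48))
    (i : Fin 4)
    (hJS : ∃ S : Finset I,
        (∀ j ∈ S, (line j).lineType = lineType (c.D.a i) (c.D.a_real i) (c.D.a_ne i)) ∧
        ∀ (Γ : Level V) (hΓ : Γ.BelowConjThree), ∀ ω ∈ R.Theta V c i Γ,
          ∃ cf : towerLevel hHD hI (ballQuotientUniformisedDatum_of h₁) h₃ hA Γ hΓ,
            TowerLevel.res hHD hI (ballQuotientUniformisedDatum_of h₁) h₃ hA cf = ω ∧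
              (ofLevel hHD hI (ballQuotientUniformisedDatum_of h₁) h₃ hA Γ hΓ cf :
                  (liuDictionaryOfWeilFamilyAut hHD hI h₁ h₃ hA V ιV I line).H) ∈
                ⨆ j ∈ S, (liuDictionaryOfWeilFamilyAut hHD hI h₁ h₃ hA V ιV I line).block j) :
    ∃ Γ₀ : Level V, ∀ Γ ≤ Γ₀,
      ∃ (M : CMField) (k : c.K →+* M) (σ' : M →+* ℂ), σ'.comp k = c.σ ∧
        R.Theta V c i Γ ⊆ (picardCMUniverse hHD hI h₁ h₃).Uiso Γ M (inflate k (c.Ψ i)) σ' :=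
  hsmall_of_weilFamily_at_of_lineType_eq hHD hI h₁ h₃ hA V ιV I line (fun i χ => (line i).IsAutChar χ) hR R c hcite hgood hrec
    h6 i hJS

/-- **E's `hsmall` OVER THE INDEXED INSTANCE OF RECORD, slot clause = ISOMETRY** (`∃ z ≠ 0, (line j).scalar = z z̄ · a_i`: the pinned
representative of the isometry class of the slot line `⟨a_i⟩` — the K0-RIDER-2-compatible reading). [folklore] -/
theorem hsmall_of_weilFamilyAut_at_of_isometric (hR : DeligneMilne1982_Thm_6_20_full)
    (R : (picardCMUniverse hHD hI h₁ h₃).ThetaModel) (c : SeesawCtx L)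
    (hcite : (liuDictionaryOfWeilFamilyAut hHD hI h₁ h₃ hA V ιV I line).Irreducible ∧
      (liuDictionaryOfWeilFamilyAut hHD hI h₁ h₃ hA V ιV I line).Prop413 ∧
      (liuDictionaryOfWeilFamilyAut hHD hI h₁ h₃ hA V ιV I line).Thm418_2 ∧
      (liuDictionaryOfWeilFamilyAut hHD hI h₁ h₃ hA V ιV I line).MuSeparated ∧
      (liuDictionaryOfWeilFamilyAut hHD hI h₁ h₃ hA V ιV I line).Thm418C)
    (hgood : R.GoodCtx ι₁ c) (hrec : SignRecipe.GoodCtx (Model.orientBitι L ι₁) ι₁ c)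
    (h6 : Module.finrank ℚ c.K = 6 ∧ IsNormalClosure ℚ c.K L ∧ (Module.finrank ℚ L = 24 ∨ Module.finrank ℚ L = 48))
    (i : Fin 4)
    (hJS : ∃ S : Finset I,
        (∀ j ∈ S, ∃ z : (L : Type), z ≠ 0 ∧ (line j).scalar = z * conjRingHomK L z * c.D.a i) ∧
        ∀ (Γ : Level V) (hΓ : Γ.BelowConjThree), ∀ ω ∈ R.Theta V c i Γ,
          ∃ cf : towerLevel hHD hI (ballQuotientUniformisedDatum_of h₁) h₃ hA Γ hΓ,
            TowerLevel.res hHD hI (ballQuotientUniformisedDatum_of h₁) h₃ hA cf = ω ∧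
              (ofLevel hHD hI (ballQuotientUniformisedDatum_of h₁) h₃ hA Γ hΓ cf :
                  (liuDictionaryOfWeilFamilyAut hHD hI h₁ h₃ hA V ιV I line).H) ∈
                ⨆ j ∈ S, (liuDictionaryOfWeilFamilyAut hHD hI h₁ h₃ hA V ιV I line).block j) :
    ∃ Γ₀ : Level V, ∀ Γ ≤ Γ₀,
      ∃ (M : CMField) (k : c.K →+* M) (σ' : M →+* ℂ), σ'.comp k = c.σ ∧
        R.Theta V c i Γ ⊆ (picardCMUniverse hHD hI h₁ h₃).Uiso Γ M (inflate k (c.Ψ i)) σ' :=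
  hsmall_of_tower_at_of_isometric hHD hI h₁ h₃ hR hA R V c I (fun j => {χ : (line j).CharW // (line j).IsAutChar χ})
    (fun j a => (line j).Ω ιV a.1) (fun j => (line j).scalar) (fun j => (line j).conj_scalar)
    (fun j => (line j).scalar_ne_zero) hcite hgood hrec h6 i hJS

end Model

end HodgeCM

end
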